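import Summits.CriticalPhenomena.PercolationContinuityZ3.Theorems.PercNearOneGluingNoHeavyLowerTailThreePointLBSwitchingMaps
import Mathlib.Tactic.FinCases
import Mathlib.Tactic.Ring
import Mathlib.Tactic.Linarith
import HarnessLib

/-!
# `NoHeavyLowerTail` (stmt-CriticalPhenomena-4575) — three-point connectivity TYPES of a configuration and
# type-table potentials: the bookkeeping layer for table-valued three-copy switching certificates

Support file (prover prim-sahi-p2; `--supports stmt-CriticalPhenomena-4575`).  No named facts, no sorries.

A three-copy switching certificate in the style of prim-lit-2 / prim-e3grp-switch-1 (files `…ThreePointLBSwitching*`,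
`…TIncSwitching*`) is a finite sum of POTENTIALS, each a function of the partition TYPES of the three terminals
`a b c` in the three output configurations of a measure-preserving switching.  This file provides the generic,
certificate-independent bookkeeping used by the `AG⁺` certificate (`…AGPlusSwitching*`):
* `tyB`, `tyP`, `ty`: the type index in `Fin 5` (`0 = abc, 1 = ab|c, 2 = ac|b, 3 = a|bc, 4 = a|b|c`) of three
  Booleans / three propositions (instance-free, classical) / a configuration;
* `cell D p a b c i = PrW {K | ty K = i}`: the five three-point cells, identified with the usual `conn`-events
  (`cell_zero` … `cell_four`), summing to `1` (`sum_cell`);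
* `sum_wt3W_table`: the expectation of a table potential `f (ty x₀) (ty x₁) (ty x₂)` over three independent copies
  is the trilinear form `Σ_{ijk} f i j k · cell i · cell j · cell k`.
-/

noncomputable section

namespace Summit.CriticalPhenomena.PercolationContinuityZ3.Theorems

namespace TypeTable

open Finset Literature.Probability.Percolation Literature.Probability.Percolation.DecisionTree
open Literature.Probability.Percolation.Gladkov ThreePointLB

/-! ### Types of three Booleans / propositions / a configuration -/

/-- The type index of the connection pattern `(ab, ac, bc)`: `0 = abc, 1 = ab|c, 2 = ac|b, 3 = a|bc, 4 = a|b|c`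
(on a transitive pattern; `bc` is only consulted when `ab = ac = false`). [folklore] -/
def tyB (ab ac bc : Bool) : Fin 5 :=
  if ab = true then (if ac = true then 0 else 1) else (if ac = true then 2 else (if bc = true then 3 else 4))

open Classical in
/-- Instance-free type index of three propositions. [folklore] -/
def tyP (P Q R : Prop) : Fin 5 :=
  if P then (if Q then 0 else 1) else (if Q then 2 else (if R then 3 else 4))

/-- `tyP` through `tyB ∘ decide`, for any decidability instances. [folklore] -/
theorem tyP_eq_tyB (P Q R : Prop) [dP : Decidable P] [dQ : Decidable Q] [dR : Decidable R] :
    tyP P Q R = tyB (@decide P dP) (@decide Q dQ) (@decide R dR) := by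
  unfold tyP tyB
  by_cases hP : P <;> by_cases hQ : Q <;> by_cases hR : R <;> simp [hP, hQ, hR]


/-! ### Instance-free Booleans of propositions -/

open Classical in
/-- Instance-free truth value of a proposition. [folklore] -/
def bP (P : Prop) : Bool := decide P

/-- `bP P = true ↔ P`. [folklore] -/
@[simp] theorem bP_eq_true_iff (P : Prop) : bP P = true ↔ P := by
  by_cases hP : P <;> simp [bP, hP]

/-- `bP P = false ↔ ¬P`. [folklore] -/
@[simp] theorem bP_eq_false_iff (P : Prop) : bP P = false ↔ ¬P := by
  by_cases hP : P <;> simp [bP, hP]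

/-- `bP` respects `↔`. [folklore] -/
theorem bP_congr {P Q : Prop} (h : P ↔ Q) : bP P = bP Q := by
  have hPQ : P = Q := propext h
  subst hPQ
  rfl

/-- `bP (P ∧ Q)`. [folklore] -/
@[simp] theorem bP_and (P Q : Prop) : bP (P ∧ Q) = (bP P && bP Q) := by
  by_cases hP : P <;> by_cases hQ : Q <;> simp [bP, hP, hQ]

/-- `bP (P ∨ Q)`. [folklore] -/
@[simp] theorem bP_or (P Q : Prop) : bP (P ∨ Q) = (bP P || bP Q) := by
  by_cases hP : P <;> by_cases hQ : Q <;> simp [bP, hP, hQ]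

/-- `bP (¬P)`. [folklore] -/
@[simp] theorem bP_not (P : Prop) : bP (¬P) = !bP P := by
  by_cases hP : P <;> simp [bP, hP]

/-- `bP` of a true proposition. [folklore] -/
theorem bP_of {P : Prop} (h : P) : bP P = true := (bP_eq_true_iff P).2 h

/-- `bP` of a false proposition. [folklore] -/
theorem bP_of_not {P : Prop} (h : ¬P) : bP P = false := (bP_eq_false_iff P).2 h

/-- `tyP` through `tyB ∘ bP`. [folklore] -/
theorem tyP_eq_bP (P Q R : Prop) : tyP P Q R = tyB (bP P) (bP Q) (bP R) := by
  unfold tyP tyB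
  by_cases hP : P <;> by_cases hQ : Q <;> by_cases hR : R <;> simp [bP, hP, hQ, hR]

/-! ### Small computable helpers (used by the per-program bounds of table certificates) -/

/-- Type `τ` has `a ~ b`. [folklore] -/
def hasAB (τ : Fin 5) : Bool := τ = 0 || τ = 1
/-- Type `τ` has `a ~ c`. [folklore] -/
def hasAC (τ : Fin 5) : Bool := τ = 0 || τ = 2
/-- Type `τ` has `b ~ c`. [folklore] -/
def hasBC (τ : Fin 5) : Bool := τ = 0 || τ = 3

/-- Type of the sealed output `X on touch (cl X a) | ω` from the input atoms (F1/F2): bits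
`(xab, xac, xab ∧ xac ∨ ¬xab ∧ AT)`, `AT = [c ~ b by ω-pairs avoiding cl X a]`. [folklore] -/
def sealTyA (xab xac at_ : Bool) : Fin 5 := tyB xab xac (xab && xac || !xab && at_)
/-- Type of the sealed output `X on touch (cl X b) | ω`: bits `(xab, xab ∧ xbc ∨ ¬xab ∧ AT, xbc)`. [folklore] -/
def sealTyB (xab xbc at_ : Bool) : Fin 5 := tyB xab (xab && xbc || !xab && at_) xbc
/-- Type of the sealed output `X on touch (cl X c) | ω`: bits `(xac ∧ xbc ∨ ¬xac ∧ AT, xac, xbc)`. [folklore] -/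
def sealTyC (xac xbc at_ : Bool) : Fin 5 := tyB (xac && xbc || !xac && at_) xac xbc


variable {V : Type*} [Fintype V] [DecidableEq V]

/-- The three-point type of a configuration `K` with respect to the terminals `a b c`
(`0 = abc, 1 = ab|c, 2 = ac|b, 3 = a|bc, 4 = a|b|c`). [folklore] -/
def ty (a b c : V) (K : Finset (Sym2 V)) : Fin 5 := tyP (b ∈ cl K a) (c ∈ cl K a) (c ∈ cl K b)

/-! ### The five cells -/

/-- The cell `i`: the probability that the type of the configuration is `i`. [folklore] -/
def cell (D : Finset (Sym2 V)) (p : Sym2 V → ℝ) (a b c : V) (i : Fin 5) : ℝ :=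
  PrW D p {K | ty a b c K = i}

section Cells

variable (D : Finset (Sym2 V)) (p : Sym2 V → ℝ) (a b c : V)

omit [DecidableEq V] in
/-- Transitivity helper: `c ∈ cl K a → c ∈ cl K b → b ∈ cl K a`. [folklore] -/
private theorem trans_cab {K : Finset (Sym2 V)} (hac : c ∈ cl K a) (hbc : c ∈ cl K b) : b ∈ cl K a :=
  mem_cl_trans hac (mem_cl_comm.1 hbc)

/-- `cell 0 = t = P(abc) = PrW (ab ∩ ac)`. [folklore] -/
theorem cell_zero : cell D p a b c 0 = PrW D p (conn a b ∩ conn a c) := by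
  refine PrW_congr_set D p fun K _ => ?_
  simp only [Set.mem_setOf_eq, Set.mem_inter_iff, mem_conn_iff_mem_cl, ty, tyP]
  by_cases h1 : b ∈ cl K a <;> by_cases h2 : c ∈ cl K a <;> by_cases h3 : c ∈ cl K b <;> simp [h1, h2, h3]

/-- `cell 1 = u_c = P(ab|c) = PrW (ab ∩ acᶜ)`. [folklore] -/
theorem cell_one : cell D p a b c 1 = PrW D p (conn a b ∩ (conn a c)ᶜ) := by
  refine PrW_congr_set D p fun K _ => ?_
  simp only [Set.mem_setOf_eq, Set.mem_inter_iff, Set.mem_compl_iff, mem_conn_iff_mem_cl, ty, tyP]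
  by_cases h1 : b ∈ cl K a <;> by_cases h2 : c ∈ cl K a <;> by_cases h3 : c ∈ cl K b <;> simp [h1, h2, h3]

/-- `cell 2 = u_b = P(ac|b) = PrW (ac ∩ abᶜ)`. [folklore] -/
theorem cell_two : cell D p a b c 2 = PrW D p (conn a c ∩ (conn a b)ᶜ) := by
  refine PrW_congr_set D p fun K _ => ?_
  simp only [Set.mem_setOf_eq, Set.mem_inter_iff, Set.mem_compl_iff, mem_conn_iff_mem_cl, ty, tyP]
  by_cases h1 : b ∈ cl K a <;> by_cases h2 : c ∈ cl K a <;> by_cases h3 : c ∈ cl K b <;> simp [h1, h2, h3]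

/-- `cell 3 = u_a = P(bc|a) = PrW (bc ∩ abᶜ)` (transitivity excludes `ac`). [folklore] -/
theorem cell_three : cell D p a b c 3 = PrW D p (conn b c ∩ (conn a b)ᶜ) := by
  refine PrW_congr_set D p fun K _ => ?_
  simp only [Set.mem_setOf_eq, Set.mem_inter_iff, Set.mem_compl_iff, mem_conn_iff_mem_cl, ty, tyP]
  by_cases h1 : b ∈ cl K a <;> by_cases h2 : c ∈ cl K a <;> by_cases h3 : c ∈ cl K b <;> simp [h1, h2, h3]
  exact h1 (trans_cab a b c h2 h3)

/-- `cell 4 = q = P(a|b|c) = PrW (abᶜ ∩ acᶜ ∩ bcᶜ)`. [folklore] -/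
theorem cell_four : cell D p a b c 4 = PrW D p ((conn a b)ᶜ ∩ ((conn a c)ᶜ ∩ (conn b c)ᶜ)) := by
  refine PrW_congr_set D p fun K _ => ?_
  simp only [Set.mem_setOf_eq, Set.mem_inter_iff, Set.mem_compl_iff, mem_conn_iff_mem_cl, ty, tyP]
  by_cases h1 : b ∈ cl K a <;> by_cases h2 : c ∈ cl K a <;> by_cases h3 : c ∈ cl K b <;> simp [h1, h2, h3]

/-- The cells sum to one. [folklore] -/
theorem sum_cell : ∑ i, cell D p a b c i = 1 := by
  unfold cell
  simp only [PrW_eq_sum_ind]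
  rw [Finset.sum_comm]
  have h : ∀ S ∈ D.powerset, ∑ i : Fin 5, wtW D p S * ind {K | ty a b c K = i} S = wtW D p S := by
    intro S _
    rw [← Finset.mul_sum]
    have : ∑ i : Fin 5, ind {K : Finset (Sym2 V) | ty a b c K = i} S = 1 := by
      rw [Finset.sum_eq_single (ty a b c S)]
      · exact ind_of_mem rfl
      · intro i _ hi
        exact ind_of_not_mem fun h => hi (Eq.symm h)
      · intro h; exact absurd (Finset.mem_univ _) h
    rw [this, mul_one]
  rw [Finset.sum_congr rfl h, ← PrW_univ (D := D) p, PrW_eq_sum_ind]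
  refine Finset.sum_congr rfl fun S _ => ?_
  rw [ind_of_mem (Set.mem_univ _), mul_one]

end Cells


/-! ### The three pair-connection bits as functions of the type -/

section Bits

variable (a b c : V) (K : Finset (Sym2 V))

/-- `[b ∈ cl K a] = hasAB (ty K)`. [folklore] -/
theorem bP_ab_eq : bP (b ∈ cl K a) = hasAB (ty a b c K) := by
  unfold ty tyP hasAB
  by_cases h1 : b ∈ cl K a <;> by_cases h2 : c ∈ cl K a <;> by_cases h3 : c ∈ cl K b <;>
    simp [bP, h1, h2, h3]

/-- `[c ∈ cl K a] = hasAC (ty K)`. [folklore] -/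
theorem bP_ac_eq : bP (c ∈ cl K a) = hasAC (ty a b c K) := by
  unfold ty tyP hasAC
  by_cases h1 : b ∈ cl K a <;> by_cases h2 : c ∈ cl K a <;> by_cases h3 : c ∈ cl K b <;>
    simp [bP, h1, h2, h3]

/-- `[c ∈ cl K b] = hasBC (ty K)` (uses transitivity of connection). [folklore] -/
theorem bP_bc_eq : bP (c ∈ cl K b) = hasBC (ty a b c K) := by
  unfold ty tyP hasBC
  by_cases h1 : b ∈ cl K a <;> by_cases h2 : c ∈ cl K a <;> by_cases h3 : c ∈ cl K b <;>
    simp [bP, h1, h2, h3]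
  · exact h3 (mem_cl_trans (mem_cl_comm.1 h1) h2)
  · exact h2 (mem_cl_trans h1 h3)
  · exact h1 (trans_cab a b c h2 h3)

end Bits

/-! ### Expectation of a type-table potential over three independent copies -/

section Table

variable (D : Finset (Sym2 V)) (p : Sym2 V → ℝ) (a b c : V)

omit [DecidableEq V] in
/-- A table potential evaluated at the types of a triple is the (one-term) indicator expansion over type triples. [folklore] -/
theorem table_eq_sum_ind (f : Fin 5 → Fin 5 → Fin 5 → ℝ) (x : Fin 3 → Finset (Sym2 V)) :
    f (ty a b c (x 0)) (ty a b c (x 1)) (ty a b c (x 2)) =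
      ∑ i, ∑ j, ∑ k, f i j k *
        ind (box {K | ty a b c K = i} {K | ty a b c K = j} {K | ty a b c K = k}) x := by
  have hind : ∀ i j k : Fin 5, ind (box {K | ty a b c K = i} {K | ty a b c K = j} {K | ty a b c K = k}) x =
      (if ty a b c (x 0) = i then 1 else 0) * (if ty a b c (x 1) = j then 1 else 0) *
        (if ty a b c (x 2) = k then 1 else 0) := by
    intro i j k
    unfold ind
    simp only [mem_box, Set.mem_setOf_eq]
    by_cases h0 : ty a b c (x 0) = i <;> by_cases h1 : ty a b c (x 1) = j <;>
      by_cases h2 : ty a b c (x 2) = k <;> simp [h0, h1, h2]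
  simp only [hind]
  simp only [Finset.sum_ite_eq, Finset.mem_univ, if_true, mul_ite, mul_one, mul_zero]

/-- **Expectation of a table potential**: `Σ_x wt3W x · f (ty x₀) (ty x₁) (ty x₂) = Σ_{ijk} f i j k · cell i · cell j · cell k`. [folklore] -/
theorem sum_wt3W_table (f : Fin 5 → Fin 5 → Fin 5 → ℝ) :
    ∑ x ∈ triples D, wt3W D p x * f (ty a b c (x 0)) (ty a b c (x 1)) (ty a b c (x 2)) =
      ∑ i, ∑ j, ∑ k, f i j k * (cell D p a b c i * cell D p a b c j * cell D p a b c k) := by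
  simp only [table_eq_sum_ind a b c f, Finset.mul_sum]
  rw [Finset.sum_comm]
  refine Finset.sum_congr rfl fun i _ => ?_
  rw [Finset.sum_comm]
  refine Finset.sum_congr rfl fun j _ => ?_
  rw [Finset.sum_comm]
  refine Finset.sum_congr rfl fun k _ => ?_
  unfold cell
  rw [← sum_wt3W_ind_box p D, Finset.mul_sum]
  refine Finset.sum_congr rfl fun x _ => ?_
  ring

end Table

end TypeTable

end Summit.CriticalPhenomena.PercolationContinuityZ3.Theorems

end
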